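import Literature.MathematicalPhysics.QuantumFieldTheory.Balaban1983to89.B6Cov2110WeightV1
import Literature.MathematicalPhysics.QuantumFieldTheory.Balaban1983to89.B6AdjointAveraging
import Literature.MathematicalPhysics.QuantumFieldTheory.Balaban1983to89.B5WalkCarrierTorus

/-!
# `Balaban1983to89.B6SchurTorusBound` — T. Bałaban, *Propagators and renormalization transformations for lattice gauge theories. II*,
# Commun. Math. Phys. **96** (1984) 223–250 [Balaban1984PropagatorsII], Sect. C p. 246 (Proposition 2.5) and [4] = *Propagators … I*
# [Balaban1984PropagatorsI] Prop. 1.1 (1.89) p. 33: THE UNDISPLAYED «KERNEL DECAY ⇒ BOUNDED OPERATOR ON L²» STEP, for RECTANGULAR kernels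
# between two carriers sitting over one unit torus `T₁ = Π_μ ℤ/M_μ` (fine sites/bonds ↦ their block, unit sites/bonds ↦ themselves)

statement-level skeleton of published theorems with citation tags; proofs where landed; nothing here is a claim about the Yang–Mills mass gap

PDF held: `paper:balaban1984-cmp96-propagators-rt-ii` (journal page = PDF page + 222), p. 241 [PDF 19], p. 246 [PDF 24]; text layer read this
session (`~/.lit/texts/paper-balaban1984-cmp96-propagators-rt-ii/p0019.txt`, `p0024.txt`).

PRINT (verbatim).  p. 241: *"From the momentum representation of (2.101) we may get easily that H′_j is a bounded operator with an exponential
decay, the bound and decay rate depending on d only"*; p. 246: *"derivatives of H′_j up to third order … are uniformly bounded and have a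
uniform exponential decay with a decay rate depending on d only. All the above considerations imply the following Proposition 2.5. The operator
G_□ defined by (2.90) … satisfies all the inequalities (1.110)–(1.114) of the Proposition 1.2"* ((1.114) of [4] p. 36 is the L²-norm member).
The step «kernel bounded by `A·e^{−δ·dist}` ⇒ operator bounded on `ℓ²`» is used silently (census C-B6-3: *"the kernel→ℓ² (Schur) conversion
is not displayed (routine)"*); the tree certifies it for SQUARE kernels on regions of `ℤ^d` (`…B6KernelComposition.mulVec_sq_le_of_decay`,
`…SchurTest.sum_sq_le`) and for non-negative rectangular kernels (`…B6AdjointAveraging.sum_sq_le`).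

CITATION HEADER (lean-in-tree rule) — WHAT IS REPRODUCED.  Phase-2 file of the `lit-balaban` typed skeleton (HOME `run/shared/lean/pub/lit-balaban/`),
seat **p22 gen 13** (B6 fold owner r03, referee ref-4; lane = Sect. C (2.95)–(2.147) on the concrete two-scale data `tsV1`; this generation's
target = the ℓ²-boundedness member of Prop. 2.5 AT TWO LEVELS).  THIS FILE = the generic tool, file 1 of 4: the rectangular Schur test for a
linear map `f : ℓ²(κ) → ℓ²(ι)` between Euclidean spaces whose matrix entries `⟨e_i, f e_k⟩` are bounded by `A·e^{−a|x_i − x_k|_T}`, the index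
sets `ι`, `κ` being placed over the unit torus `Tor M` by maps with fibres of size `≤ N_ι`, `≤ N_κ` (fine points ↦ their block: `N = (L^j)^{d+1}`;
unit sites: `N = 1`; bonds: a factor `d + 1`), `|·|_T` the torus sup-metric of box representatives of the b04/b05 lineage
(`B4TorusKernel.MultiPeriod.torusSupNorm`, `B6LowerBound2153Torus.rep`): **`‖f x‖ ≤ A·K_{d+1}(a)·√(N_ιN_κ)·‖x‖`** with King's lattice
constant `K_{d+1}(a) = B4Sect5Proof.latticeConst (d+1) a` (`B5Hk163TorusHolderRate.sum_exp_torusSupNorm_sub_rep_le` BY NAME) — uniformly in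
the period vector `M`.  IMPORTS BY NAME, restating nothing: `…B6AdjointAveraging.sum_sq_le` (rectangular Schur test for non-negative kernels),
`…B6Cov2110WeightV1.torusSupNorm_neg`, `…B5Hk163TorusHolderRate.sum_exp_torusSupNorm_sub_rep_le`, p38's `…B5WalkCarrierTorus.normSq_eq` (`‖f‖² = Σ_i f_i²`).  THEOREMS ONLY (no definition, no
`def … : Prop`); standard axioms.  HONEST SCOPE: an elementary finite-dimensional lemma (ours; the papers display nothing here); the
dimension is written `d + 1` as in the b04 torus files; NOT summit progress.  Unit `lit-balaban-p22` (gen 13), 2026-08-22.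
-/

noncomputable section

open scoped InnerProductSpace BigOperators
open Finset

namespace Literature.MathematicalPhysics.QuantumFieldTheory.Balaban1983to89.B6SchurTorusBound

open B5Prop11Plancherel (Tor)
open B4TorusKernel.MultiPeriod (torusSupNorm)
open B4Sect5Proof (latticeConst latticeConst_nonneg)
open B6LowerBound2153Torus (rep)
open B5Hk163TorusHolderRate (sum_exp_torusSupNorm_sub_rep_le)
open B6Cov2110WeightV1 (torusSupNorm_neg)
open B5WalkCarrierTorus (normSq_eq)

/-! ## §1  The rectangular Schur test for signed kernels -/

section Schur

variable {ι κ : Type*} [Fintype ι] [Fintype κ]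

/-- **Rectangular Schur test, signed kernel**: row sums of `|T|` at most `R ≥ 0`, column sums at most `C` ⇒ `‖Tx‖₂² ≤ R·C·‖x‖₂²`
(`…B6AdjointAveraging.sum_sq_le` applied to `|T|`). [cite: Balaban1984PropagatorsII, p.241, text after (2.101) («H′_j is a bounded operator»: the undisplayed kernel → ℓ² step; statement and proof ours)] -/
theorem sum_sq_le_abs (T : ι → κ → ℝ) (x : κ → ℝ) {R C : ℝ} (hR0 : 0 ≤ R) (hR : ∀ i, ∑ k, |T i k| ≤ R)
    (hC : ∀ k, ∑ i, |T i k| ≤ C) : ∑ i, (∑ k, T i k * x k) ^ 2 ≤ R * C * ∑ k, x k ^ 2 := by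
  have h1 : ∀ i, (∑ k, T i k * x k) ^ 2 ≤ (∑ k, |T i k| * |x k|) ^ 2 := fun i => by
    rw [← sq_abs (∑ k, T i k * x k)]
    refine pow_le_pow_left₀ (abs_nonneg _) ?_ 2
    refine (Finset.abs_sum_le_sum_abs _ _).trans (le_of_eq ?_)
    exact Finset.sum_congr rfl fun k _ => abs_mul _ _
  calc ∑ i, (∑ k, T i k * x k) ^ 2 ≤ ∑ i, (∑ k, |T i k| * |x k|) ^ 2 := Finset.sum_le_sum fun i _ => h1 i
    _ ≤ R * C * ∑ k, |x k| ^ 2 :=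
        B6AdjointAveraging.sum_sq_le (fun i k => |T i k|) (fun _ _ => abs_nonneg _) (fun k => |x k|) hR0 hR hC
    _ = R * C * ∑ k, x k ^ 2 := by simp_rw [sq_abs]

end Schur

/-! ## §2  Linear maps between Euclidean spaces: matrix entries and the Schur bound -/

section Euclid

variable {ι κ : Type} [Fintype ι] [Fintype κ] [DecidableEq κ]

/-- a vector of `ℓ²(κ)` is the combination `Σ_k x_k e_k` of the basis vectors. [cite: Balaban1984PropagatorsI, (1.108) p.35 (the ℓ² norm on lattice functions; elementary identity, ours)] -/
theorem eq_sum_single (x : EuclideanSpace ℝ κ) : x = ∑ k, x k • EuclideanSpace.single k (1 : ℝ) := by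
  conv_lhs => rw [← (EuclideanSpace.basisFun κ ℝ).sum_repr x]
  refine Finset.sum_congr rfl fun k _ => ?_
  rw [EuclideanSpace.basisFun_repr, EuclideanSpace.basisFun_apply]

omit [Fintype ι] in
/-- **the coordinates of `f x` through the matrix entries `f(e_k)_i`**: `(f x)_i = Σ_k f(e_k)_i·x_k`. [cite: Balaban1984PropagatorsI, (1.108) p.35 (the ℓ² norm on lattice functions; elementary identity, ours)] -/
theorem apply_eq_sum_entry (f : EuclideanSpace ℝ κ →ₗ[ℝ] EuclideanSpace ℝ ι) (x : EuclideanSpace ℝ κ) (i : ι) :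
    f x i = ∑ k, f (EuclideanSpace.single k (1 : ℝ)) i * x k := by
  conv_lhs => rw [eq_sum_single x, map_sum]
  rw [WithLp.ofLp_sum, Finset.sum_apply]
  refine Finset.sum_congr rfl fun k _ => ?_
  rw [map_smul, WithLp.ofLp_smul, Pi.smul_apply, smul_eq_mul, mul_comm]

/-- **Schur bound for a linear map between Euclidean spaces**: row sums `≤ R ≥ 0` and column sums `≤ C` of the absolute matrix entries
`|f(e_k)_i|` ⇒ `‖f x‖² ≤ R·C·‖x‖²`. [cite: Balaban1984PropagatorsII, p.241, text after (2.101) («H′_j is a bounded operator»: the undisplayed kernel → ℓ² step; statement and proof ours)] -/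
theorem norm_sq_le_of_schur (f : EuclideanSpace ℝ κ →ₗ[ℝ] EuclideanSpace ℝ ι) {R C : ℝ} (hR0 : 0 ≤ R)
    (hR : ∀ i, ∑ k, |f (EuclideanSpace.single k (1 : ℝ)) i| ≤ R) (hC : ∀ k, ∑ i, |f (EuclideanSpace.single k (1 : ℝ)) i| ≤ C)
    (x : EuclideanSpace ℝ κ) : ‖f x‖ ^ 2 ≤ R * C * ‖x‖ ^ 2 := by
  rw [normSq_eq (f x), normSq_eq x]
  have h := sum_sq_le_abs (fun i k => f (EuclideanSpace.single k (1 : ℝ)) i) (fun k => x k) hR0 hR hC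
  refine le_trans (le_of_eq (Finset.sum_congr rfl fun i _ => ?_)) h
  rw [apply_eq_sum_entry]

/-- … hence `‖f x‖ ≤ √(R·C)·‖x‖`. [cite: Balaban1984PropagatorsII, p.241, text after (2.101) («H′_j is a bounded operator»: the undisplayed kernel → ℓ² step; statement and proof ours)] -/
theorem norm_le_of_schur (f : EuclideanSpace ℝ κ →ₗ[ℝ] EuclideanSpace ℝ ι) {R C : ℝ} (hR0 : 0 ≤ R)
    (hR : ∀ i, ∑ k, |f (EuclideanSpace.single k (1 : ℝ)) i| ≤ R) (hC : ∀ k, ∑ i, |f (EuclideanSpace.single k (1 : ℝ)) i| ≤ C)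
    (x : EuclideanSpace ℝ κ) : ‖f x‖ ≤ Real.sqrt (R * C) * ‖x‖ := by
  have h := norm_sq_le_of_schur f hR0 hR hC x
  calc ‖f x‖ = Real.sqrt (‖f x‖ ^ 2) := (Real.sqrt_sq (norm_nonneg _)).symm
    _ ≤ Real.sqrt (R * C * ‖x‖ ^ 2) := Real.sqrt_le_sqrt h
    _ = Real.sqrt (R * C) * ‖x‖ := by rw [Real.sqrt_mul' _ (sq_nonneg _), Real.sqrt_sq (norm_nonneg _)]

end Euclid

/-! ## §3  Exponential row sums over carriers placed over the unit torus -/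

section TorusSums

variable {d : ℕ} (M : Fin (d + 1) → ℕ) [hM : ∀ μ, NeZero (M μ)]

/-- summing a non-negative function of the torus position over a carrier with fibres of size `≤ N` costs at most the factor `N`. [cite: Balaban1984PropagatorsII, p.241, text after (2.101) («H′_j is a bounded operator»: the undisplayed kernel → ℓ² step; statement and proof ours)] -/
theorem sum_comp_le_of_fiber {β : Type*} [Fintype β] (π : β → Tor M) {N : ℕ}
    (hN : ∀ t, (Finset.univ.filter fun b => π b = t).card ≤ N) (g : Tor M → ℝ) (hg : ∀ t, 0 ≤ g t) :
    ∑ b, g (π b) ≤ N * ∑ t, g t := by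
  classical
  rw [Finset.sum_comp]
  calc ∑ t ∈ Finset.univ.image π, (Finset.univ.filter fun b => π b = t).card • g t
      ≤ ∑ t ∈ Finset.univ.image π, (N : ℝ) * g t := by
        refine Finset.sum_le_sum fun t _ => ?_
        rw [nsmul_eq_mul]
        exact mul_le_mul_of_nonneg_right (by exact_mod_cast hN t) (hg t)
    _ ≤ ∑ t, (N : ℝ) * g t :=
        Finset.sum_le_sum_of_subset_of_nonneg (Finset.subset_univ _) fun t _ _ => mul_nonneg (Nat.cast_nonneg _) (hg t)
    _ = N * ∑ t, g t := by rw [Finset.mul_sum]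

/-- **UNIFORM ROW SUMS**: `Σ_b e^{−a|y − x_b|_T} ≤ N·K_{d+1}(a)` for any carrier `b ↦ x_b = rep(π b)` over the unit torus with fibres `≤ N`
(`a > 0`; `B5Hk163TorusHolderRate.sum_exp_torusSupNorm_sub_rep_le` BY NAME), uniformly in the period vector. [cite: Balaban1984PropagatorsII, p.241, text after (2.101) («H′_j is a bounded operator»: the undisplayed kernel → ℓ² step; statement and proof ours)] -/
theorem rowSum_exp_le {β : Type*} [Fintype β] (π : β → Tor M) {N : ℕ}
    (hN : ∀ t, (Finset.univ.filter fun b => π b = t).card ≤ N) {a : ℝ} (ha : 0 < a) (y : Fin (d + 1) → ℤ) :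
    ∑ b, Real.exp (-(a * torusSupNorm M (y - rep M (π b)))) ≤ N * latticeConst (d + 1) a :=
  (sum_comp_le_of_fiber M π hN (fun t => Real.exp (-(a * torusSupNorm M (y - rep M t)))) fun _ => (Real.exp_pos _).le).trans
    (mul_le_mul_of_nonneg_left (sum_exp_torusSupNorm_sub_rep_le M ha y) (Nat.cast_nonneg _))

/-- the same with the difference reversed (`|x_b − y|_T = |y − x_b|_T`). [cite: Balaban1984PropagatorsII, p.241, text after (2.101) («H′_j is a bounded operator»: the undisplayed kernel → ℓ² step; statement and proof ours)] -/
theorem rowSum_exp_le' {β : Type*} [Fintype β] (π : β → Tor M) {N : ℕ}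
    (hN : ∀ t, (Finset.univ.filter fun b => π b = t).card ≤ N) {a : ℝ} (ha : 0 < a) (y : Fin (d + 1) → ℤ) :
    ∑ b, Real.exp (-(a * torusSupNorm M (rep M (π b) - y))) ≤ N * latticeConst (d + 1) a := by
  refine le_trans (le_of_eq (Finset.sum_congr rfl fun b _ => ?_)) (rowSum_exp_le M π hN ha y)
  rw [← torusSupNorm_neg M, neg_sub]

end TorusSums

/-! ## §4  Kernel decay between two carriers over the unit torus ⇒ bounded operator -/

section Decay

variable {d : ℕ} (M : Fin (d + 1) → ℕ) [hM : ∀ μ, NeZero (M μ)]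
variable {ι κ : Type} [Fintype ι] [Fintype κ]

/-- **«KERNEL DECAY ⇒ BOUNDED ON ℓ²», RECTANGULAR, UNIFORM IN THE VOLUME — raw kernel form**: if `|T_{ik}| ≤ A·e^{−a|x_i − x_k|_T}` with
`x_i = rep(p_ι i)`, `x_k = rep(p_κ k)` the box representatives of torus positions whose fibres have at most `N_ι`, `N_κ` elements, then
`Σ_i (Σ_k T_{ik}x_k)² ≤ (A·K_{d+1}(a))²·N_ιN_κ·Σ_k x_k²`. [cite: Balaban1984PropagatorsII, p.241 («H′_j is a bounded operator with an exponential decay»; the kernel → L² step, ours)] -/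
theorem sum_sq_le_of_entry_decay (T : ι → κ → ℝ) (pι : ι → Tor M) (pκ : κ → Tor M)
    {Nι Nκ : ℕ} (hNι : ∀ t, (Finset.univ.filter fun i => pι i = t).card ≤ Nι)
    (hNκ : ∀ t, (Finset.univ.filter fun k => pκ k = t).card ≤ Nκ) {A a : ℝ} (hA : 0 ≤ A) (ha : 0 < a)
    (hT : ∀ i k, |T i k| ≤ A * Real.exp (-(a * torusSupNorm M (rep M (pι i) - rep M (pκ k)))))
    (x : κ → ℝ) :
    ∑ i, (∑ k, T i k * x k) ^ 2 ≤ (A * latticeConst (d + 1) a) ^ 2 * (Nι * Nκ) * ∑ k, x k ^ 2 := by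
  have hR : ∀ i, ∑ k, |T i k| ≤ A * (Nκ * latticeConst (d + 1) a) := fun i => by
    refine (Finset.sum_le_sum fun k _ => hT i k).trans ?_
    rw [← Finset.mul_sum]
    exact mul_le_mul_of_nonneg_left (rowSum_exp_le M pκ hNκ ha (rep M (pι i))) hA
  have hC : ∀ k, ∑ i, |T i k| ≤ A * (Nι * latticeConst (d + 1) a) := fun k => by
    refine (Finset.sum_le_sum fun i _ => hT i k).trans ?_
    rw [← Finset.mul_sum]
    exact mul_le_mul_of_nonneg_left (rowSum_exp_le' M pι hNι ha (rep M (pκ k))) hA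
  have hΛ : 0 ≤ latticeConst (d + 1) a := latticeConst_nonneg _ ha.le
  have h := sum_sq_le_abs T x (by positivity) hR hC
  calc ∑ i, (∑ k, T i k * x k) ^ 2 ≤ A * (Nκ * latticeConst (d + 1) a) * (A * (Nι * latticeConst (d + 1) a)) * ∑ k, x k ^ 2 := h
    _ = (A * latticeConst (d + 1) a) ^ 2 * (Nι * Nκ) * ∑ k, x k ^ 2 := by ring

variable [DecidableEq κ]

/-- **«KERNEL DECAY ⇒ BOUNDED ON ℓ²» for a linear map between Euclidean spaces**: if `|⟨e_i, f e_k⟩| ≤ A·e^{−a|x_i − x_k|_T}` (positions and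
fibres as above), then `‖f x‖² ≤ (A·K_{d+1}(a))²·N_ιN_κ·‖x‖²`. [cite: Balaban1984PropagatorsII, p.241 («H′_j is a bounded operator with an exponential decay»; the kernel → L² step, ours)] -/
theorem norm_sq_le_of_entry_decay (f : EuclideanSpace ℝ κ →ₗ[ℝ] EuclideanSpace ℝ ι) (pι : ι → Tor M) (pκ : κ → Tor M)
    {Nι Nκ : ℕ} (hNι : ∀ t, (Finset.univ.filter fun i => pι i = t).card ≤ Nι)
    (hNκ : ∀ t, (Finset.univ.filter fun k => pκ k = t).card ≤ Nκ) {A a : ℝ} (hA : 0 ≤ A) (ha : 0 < a)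
    (hf : ∀ i k, |f (EuclideanSpace.single k (1 : ℝ)) i| ≤
      A * Real.exp (-(a * torusSupNorm M (rep M (pι i) - rep M (pκ k)))))
    (x : EuclideanSpace ℝ κ) :
    ‖f x‖ ^ 2 ≤ (A * latticeConst (d + 1) a) ^ 2 * (Nι * Nκ) * ‖x‖ ^ 2 := by
  rw [normSq_eq (f x), normSq_eq x]
  have h := sum_sq_le_of_entry_decay M (fun i k => f (EuclideanSpace.single k (1 : ℝ)) i) pι pκ hNι hNκ hA ha hf (fun k => x k)
  refine le_trans (le_of_eq (Finset.sum_congr rfl fun i _ => ?_)) h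
  rw [apply_eq_sum_entry]

/-- … and `‖f x‖ ≤ A·K_{d+1}(a)·√(N_ιN_κ)·‖x‖`. [cite: Balaban1984PropagatorsII, p.241 («H′_j is a bounded operator with an exponential decay»; the kernel → L² step, ours)] -/
theorem norm_le_of_entry_decay (f : EuclideanSpace ℝ κ →ₗ[ℝ] EuclideanSpace ℝ ι) (pι : ι → Tor M) (pκ : κ → Tor M)
    {Nι Nκ : ℕ} (hNι : ∀ t, (Finset.univ.filter fun i => pι i = t).card ≤ Nι)
    (hNκ : ∀ t, (Finset.univ.filter fun k => pκ k = t).card ≤ Nκ) {A a : ℝ} (hA : 0 ≤ A) (ha : 0 < a)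
    (hf : ∀ i k, |f (EuclideanSpace.single k (1 : ℝ)) i| ≤
      A * Real.exp (-(a * torusSupNorm M (rep M (pι i) - rep M (pκ k)))))
    (x : EuclideanSpace ℝ κ) :
    ‖f x‖ ≤ A * latticeConst (d + 1) a * Real.sqrt (Nι * Nκ) * ‖x‖ := by
  have h := norm_sq_le_of_entry_decay M f pι pκ hNι hNκ hA ha hf x
  have hΛ : 0 ≤ latticeConst (d + 1) a := latticeConst_nonneg _ ha.le
  have h0 : 0 ≤ A * latticeConst (d + 1) a * Real.sqrt (Nι * Nκ) * ‖x‖ := by positivity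
  have h2 : ‖f x‖ ^ 2 ≤ (A * latticeConst (d + 1) a * Real.sqrt (Nι * Nκ) * ‖x‖) ^ 2 := by
    calc ‖f x‖ ^ 2 ≤ (A * latticeConst (d + 1) a) ^ 2 * (Nι * Nκ) * ‖x‖ ^ 2 := h
      _ = (A * latticeConst (d + 1) a * Real.sqrt (Nι * Nκ) * ‖x‖) ^ 2 := by
          have hs : Real.sqrt ((Nι : ℝ) * Nκ) ^ 2 = (Nι : ℝ) * Nκ := Real.sq_sqrt (by positivity)
          rw [show (A * latticeConst (d + 1) a * Real.sqrt (Nι * Nκ) * ‖x‖) ^ 2 =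
            (A * latticeConst (d + 1) a) ^ 2 * Real.sqrt ((Nι : ℝ) * Nκ) ^ 2 * ‖x‖ ^ 2 by ring, hs]
  exact le_of_sq_le_sq h2 h0

end Decay

end Literature.MathematicalPhysics.QuantumFieldTheory.Balaban1983to89.B6SchurTorusBound

end
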